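import Summits.QuantumFields.YangMills.Theorems.UnitScaleTiltProp8FlatHWholeBridge
import Summits.QuantumFields.YangMills.Theorems.UnitScaleTiltProp8FlatHCurlCurl
import Literature.MathematicalPhysics.QuantumFieldTheory.Balaban1983to89.B6Cor28TwoScaleV1
import HarnessLib

/-!
# Route `UnitScaleTilt`, crux K1 child «MinimiserStabilityRegPr» (stmt-QuantumFields-19200), v8 pillar **P2 `stub_flatOpsCubeSeq`** — one-level target, row (k3):
# **THE `∂*∂H` KERNEL ROW (k3) OF `FlatOpsHRowsFromKernels.HKernelRows` HOLDS AT THE ONE-LEVEL FAMILY `Domains.whole (K − n)`** — by the exact identity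
# [Balaban1985Variational] (137) `∂*∂H = Q*((QGQ*)⁻¹ − a)` (`FlatHCurlCurl`) and lit-balaban r03's TWO-SCALE kernel bounds for `Q*(QGQ*)⁻¹` and `Q*`
# ([Balaban1984PropagatorsII] (2.148)/(2.150): `B6Cor28TwoScaleV1.blockBound_QsRinv_scaling`, `blockBound_Q_adjoint`) at the empty top `Λ′ = ∅`

Cell `ym3-torus` (HUMAN RULING D-0037, YM ladder rung R3), seat `ym3-torus-p1` gen 16.  `--supports stmt-QuantumFields-19200 --as helper`; count-neutral; def-free.

THE PRINT.  [Balaban1985Variational] (137) p. 298 (exact, `FlatHCurlCurl.curlCurl_hOp`); [Balaban1984PropagatorsII] (2.148) p. 249 *«|(QGQ*)⁻¹(y, y′)| ≦ O(1)(Lʲη)⁻²(L^{j′}η)^{−d}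
e^{−δ₄d(y,y′)}»*, (2.150) (the kernel normalisation), p. 224 *«Ω_j = T_η for j = 1, …, l»* (the one-level family); r03's two-scale layer ([Balaban1984PropagatorsII] Sect. C,
`twoScale j hj Λ′`) at `Λ′ = ∅` IS the one-level family up to the index bookkeeping of `FlatDomainsCongr`.

WHAT IS PROVED (sorry-free; axioms standard; no definition).
* §1 **`toLp_H_eq_hOp_twoScale_empty`** — p1 g14's flat `H` is ALSO `hOp` of r03's `twoScale j hj ∅` (any weights): same proof as
  `FlatHWholeBridge.toLp_H_eq_hOp_whole` (criticality + uniqueness), no transport of `R` needed;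
* §2 **`curlCurl_flatH_whole_single`** — for the indicator `e_c` of an index bond `c = (K−n, cb)` of `whole (K−n)`:
  `∂*∂(flatH e_c) = Q_ts*((QGQ*)_ts⁻¹ e_{ι cb}) − a·Q_ts*(e_{ι cb})` read through r03's reindexing (`B6Eq235TwoScaleV1.QsE_eq`/`EE_eq`/`reindex_symm_single`), at the
  weight `a = (L^{K−n})³` (window `a₀ = a₁ = 1` of `blockBound_QsRinv_scaling`);
* §3 **`hKernelRow3_whole`** — ROW (k3) AT THE ONE-LEVEL FAMILY: for odd `L > 1` there are `δ₃ > 0`, `C₃ ≥ 0` (r03's constants at `d + 1 = 3`, `a₀ = a₁ = 1`) with, for every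
  member `F.L = L`, heights `n < K`, P2 weights `w`, index bond `c`, indicator `e_c`, fine bond `b`:
  `w 3 b · |(∂^{η*}∂^η flatH e_c)(b)| ≤ C₃·e^{−δ₃·distBI(b,c)}` (`w ≡ 1` there; `distBI` = the block distance; `a·η³ = 1` cancels `Q*`'s volume factor).
So at the one-level family the `H`-side of P2 is reduced to the SINGLE Laplacian kernel row (k4) ([Balaban1985Variational] (130) = (137) + (140) `DPD*H`).
HONEST SCOPE: bookkeeping over landed certificates (p1 g14 menu, p21 Sect. A, r03 Sect. C two-scale layer); NOT a claim about the mass gap.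

References: T. Bałaban, CMP **102** (1985) 277–309 [Balaban1985Variational] (137)–(140) p.298–299; CMP **96** (1984) 223–250 [Balaban1984PropagatorsII] (2.35) p.228,
(2.148)–(2.151) p.249; CMP **95** (1984) 17–40 [Balaban1984PropagatorsI] (1.63) p.29.
-/

set_option autoImplicit false

noncomputable section

open scoped BigOperators InnerProductSpace Matrix

namespace Summit.QuantumFields.YangMills.Theorems.FlatHCurlCurlWhole

open Literature.MathematicalPhysics.QuantumFieldTheory.Balaban1983to89
open Literature.MathematicalPhysics.QuantumFieldTheory.BalabanImbrieJaffe1984to88.BIJ85AxialPropagator411 (BondSpace)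
open LatticeFieldCalculus (bondAvgIter curlAction)
open B6SectADomainsV1 (Domains)
open B6SectAOperatorsV1 (BondIdx BondIdxSpace QE QsE aE dsE dcE dcsE RE QE_apply aE_apply)
open B6SectAVectorModelV1 (GE EE)
open B6SectACriticalPointV1 (isCritical_iff_eq_hOp)
open B6Eq218Lagrangian (IsCritical Admissible energy isCritical_of_isMinOn)
open B6SectA (hOp)
open B6SectCTwoScaleV1 (twoScale CIdx OutBond InBond CSpace wPrinted)
open B6SectCTwoScaleV1Lattice (tsV1)
open B6Eq2129TwoScaleV1 (toBondIdx toBondIdx_bijective wLevel wLevel_pos)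
open B6Eq2143TwoScaleV1 (QGQs)
open B6Eq235TwoScaleV1 (reindex)
open B5Eq117TorusCarriers (Mk tV tB)
open B5Eq118OneStroke (iterBlockOf)
open B5Prop12FieldsLattice (distSite)
open B5SectBStatements (cplx eta)
open B5TowerOneStroke (pullR)
open B5Hk163Torus (HkOp)
open B4TorusKernel.MultiPeriod (torusSupNorm)
open B6LowerBound2153Torus (rep)
open T3ContinuumYM3Torus (T3Family)
open FlatCubeOpsText (distBI IsLevWeight)
open FlatOpsLettersAssembly (flatH)
open FlatDomainsCongr (lamBond_whole_iff lamBond_twoScale_empty_iff)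
open FlatHWholeBridge (curlAction_ofLp_eq flatH_whole_apply)
open Prop7FlatCoercivityR (succ_le_T3)
open FlatMinimizerH (le_T3)

variable {P : Params} {j : ℕ}

/-! ## §1 p1 g14's `H` is `hOp` of r03's `twoScale j hj ∅` -/

/-- **THE ONE-LEVEL FLAT `H` IS `GQ*(QGQ*)⁻¹` OF `twoScale j hj ∅`** (any positive weights): for data `X` on its index bonds (all at level `j`) and the reading
`b_X(cb) = X(j, cb)`, `Hb_X = hOp … X` — admissible (`bondAvgIter_H_eq`, `RE_dsE_H_eq_zero`) and minimising (`curlAction_H_le`), hence the critical configuration.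
[cite: Balaban1984PropagatorsII, (2.35) p.228; Balaban1984PropagatorsI, (1.63) p.29] -/
theorem toLp_H_eq_hOp_twoScale_empty (hj1 : j + 1 ≤ P.m + P.K) (hc : ((P.L : ℝ) ^ j) ≠ 0)
    {w : BondIdx (twoScale j hj1 (∅ : Finset (Site P (j + 1)))) → ℝ} (hw : ∀ i, 0 < w i)
    (X : BondIdx (twoScale j hj1 (∅ : Finset (Site P (j + 1)))) → ℝ) :
    WithLp.toLp 2 ((tV (Nat.le_of_succ_le hj1)).symm (pullR P.L (Mk P j) j (HkOp (P.L ^ j) (Mk P j) *ᵥ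
        cplx (tB (fun cb : PBond P j => X ⟨⟨⟨j, by show j < j + 1 + 1; exact Nat.lt_succ_of_lt (Nat.lt_succ_self j)⟩, cb⟩,
          (lamBond_twoScale_empty_iff hj1 j cb).2 rfl⟩))))) =
      hOp (GE (twoScale j hj1 (∅ : Finset (Site P (j + 1)))) hc hw) (QsE _) (EE (twoScale j hj1 (∅ : Finset (Site P (j + 1)))) hc hw)
        (WithLp.toLp 2 X) := by
  haveI : NeZero P.L := ⟨P.L_pos.ne'⟩
  have hjlt : j < (twoScale j hj1 (∅ : Finset (Site P (j + 1)))).k + 1 := by show j < j + 1 + 1; omega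
  set bX : VecField P j ℝ := fun cb : PBond P j => X ⟨⟨⟨j, hjlt⟩, cb⟩, (lamBond_twoScale_empty_iff hj1 j cb).2 rfl⟩ with hbX
  set Hg : VecField P 0 ℝ := (tV (Nat.le_of_succ_le hj1)).symm (pullR P.L (Mk P j) j (HkOp (P.L ^ j) (Mk P j) *ᵥ cplx (tB bX))) with hHg
  rw [← isCritical_iff_eq_hOp (twoScale j hj1 (∅ : Finset (Site P (j + 1)))) hc hw (WithLp.toLp 2 X) (WithLp.toLp 2 Hg)]
  have hread : ∀ y : BondSpace P, QE (twoScale j hj1 (∅ : Finset (Site P (j + 1)))) y = WithLp.toLp 2 X ↔ bondAvgIter j (WithLp.ofLp y) = bX := by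
    intro y
    constructor
    · intro h
      funext cb
      have := congrArg (fun v : BondIdxSpace (twoScale j hj1 (∅ : Finset (Site P (j + 1)))) => v ⟨⟨⟨j, hjlt⟩, cb⟩, (lamBond_twoScale_empty_iff hj1 j cb).2 rfl⟩) h
      simpa using this
    · intro h
      ext i
      obtain ⟨⟨⟨i₀, hi⟩, cb⟩, hmem⟩ := i
      obtain rfl : i₀ = j := (lamBond_twoScale_empty_iff hj1 i₀ cb).1 hmem
      rw [QE_apply]
      change bondAvgIter i₀ (WithLp.ofLp y) cb = X _
      rw [h]
  have hQ : QE (twoScale j hj1 (∅ : Finset (Site P (j + 1)))) (WithLp.toLp 2 Hg) = WithLp.toLp 2 X :=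
    (hread _).2 (by rw [hHg]; exact FlatMinimizerH.bondAvgIter_H_eq (Nat.le_of_succ_le hj1) bX)
  have hR : RE (twoScale j hj1 (∅ : Finset (Site P (j + 1)))) ((P.L : ℝ) ^ j) (dsE ((P.L : ℝ) ^ j) (WithLp.toLp 2 Hg)) = 0 :=
    FlatMinimizerHLandau.RE_dsE_H_eq_zero hj1 bX
  refine isCritical_of_isMinOn ⟨hQ, hR⟩ fun y hy => ?_
  have hA : bondAvgIter j (WithLp.ofLp y) = bX := (hread y).1 hy.1
  have hmin := FlatMinimizerHLandau.curlAction_H_le (Nat.le_of_succ_le hj1) bX (WithLp.ofLp y) hA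
  rw [← hHg, show Hg = WithLp.ofLp (WithLp.toLp 2 Hg) from rfl, curlAction_ofLp_eq, curlAction_ofLp_eq] at hmin
  have hη : 0 < eta P.L j ^ P.d / 2 := by
    have : 0 < eta P.L j := by unfold eta; positivity
    positivity
  exact le_of_mul_le_mul_left hmin hη

/-! ## §2 `∂*∂(flatH e_c)` at the one-level family through r03's reindexing -/

section Carrier

variable (F : T3Family) (n K : ℕ)

open Classical in
/-- **`∂*∂(flatH e_c)` AT `whole (K−n)`, READ IN r03's TWO-SCALE LETTERS**: for the indicator `e_c` of the index bond `c = (K−n, cb)` and `i₀ := inl cb ∈ 𝔅 = Λ^c ⊔ ∅`,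
`∂*∂(flatH e_c) = Q*((QGQ*)⁻¹e_{i₀}) − a·Q*(e_{i₀})` with r03's `Q = (tsV1 …).Q`, `(QGQ*)⁻¹ = Ring.inverse QGQs` at the weight `a = (L^{K−n})³` — (137) (`FlatHCurlCurl.curlCurl_hOp`)
for `hOp` of `twoScale (K−n) ∅` (§1 + `FlatHWholeBridge.flatH_whole_apply`: the same fine field) and `B6Eq235TwoScaleV1.QsE_eq`/`EE_eq`/`reindex_symm_single`.
[cite: Balaban1985Variational, (137) p.298; Balaban1984PropagatorsII, (2.35) p.228, (2.148)-(2.150) p.249] -/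
theorem curlCurl_flatH_whole_single (cb : PBond (F.P K) (K - n))
    (e : BondIdx (Domains.whole (K - n) (le_T3 F n K) : Domains (F.P K)) → ℝ)
    (he : e ⟨⟨⟨K - n, Nat.lt_succ_self (K - n)⟩, cb⟩, (lamBond_whole_iff (le_T3 F n K) (K - n) cb).2 rfl⟩ = 1)
    (he' : ∀ c', c' ≠ ⟨⟨⟨K - n, Nat.lt_succ_self (K - n)⟩, cb⟩, (lamBond_whole_iff (le_T3 F n K) (K - n) cb).2 rfl⟩ → e c' = 0) :
    dcsE ((F.L : ℝ) ^ (K - n)) (dcE ((F.L : ℝ) ^ (K - n)) (WithLp.toLp 2 (flatH F n K (Domains.whole (K - n) (le_T3 F n K)) e))) =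
      (LinearMap.adjoint (tsV1 (P := F.P K) (c := (F.L : ℝ) ^ (K - n)) (pow_ne_zero _ (Nat.cast_ne_zero.2 (F.P K).L_pos.ne'))
            (∅ : Finset (Site (F.P K) (K - n + 1))) (wPrinted (F.P K) (K - n) ∅ (((F.L : ℝ) ^ (K - n)) ^ 3))).Q ∘ₗ
        Ring.inverse (QGQs (P := F.P K) (c := (F.L : ℝ) ^ (K - n)) (pow_ne_zero _ (Nat.cast_ne_zero.2 (F.P K).L_pos.ne'))
          (∅ : Finset (Site (F.P K) (K - n + 1))) (w := wPrinted (F.P K) (K - n) ∅ (((F.L : ℝ) ^ (K - n)) ^ 3))))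
        (EuclideanSpace.single (Sum.inl ⟨cb, Finset.notMem_empty _, Finset.notMem_empty _⟩) (1 : ℝ)) -
      ((F.L : ℝ) ^ (K - n)) ^ 3 •
        LinearMap.adjoint (tsV1 (P := F.P K) (c := (F.L : ℝ) ^ (K - n)) (pow_ne_zero _ (Nat.cast_ne_zero.2 (F.P K).L_pos.ne'))
            (∅ : Finset (Site (F.P K) (K - n + 1))) (wPrinted (F.P K) (K - n) ∅ (((F.L : ℝ) ^ (K - n)) ^ 3))).Q
          (EuclideanSpace.single (Sum.inl ⟨cb, Finset.notMem_empty _, Finset.notMem_empty _⟩) (1 : ℝ)) := by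
  have hj1 : K - n + 1 ≤ (F.P K).m + (F.P K).K := succ_le_T3 F n K
  have hc : ((F.L : ℝ) ^ (K - n)) ≠ 0 := pow_ne_zero _ (Nat.cast_ne_zero.2 (F.P K).L_pos.ne')
  have ha : (0 : ℝ) < ((F.L : ℝ) ^ (K - n)) ^ 3 := by
    have : (0 : ℝ) < (F.L : ℝ) := by exact_mod_cast lt_trans zero_lt_one F.hL.2
    positivity
  have hjlt : K - n < (twoScale (K - n) hj1 (∅ : Finset (Site (F.P K) (K - n + 1)))).k + 1 := by
    show K - n < K - n + 1 + 1; omega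
  -- the reading of `e` at level `K − n` is the indicator of `cb`; so is the reading of `e_{ι cb}` on the two-scale side
  have hread : (fun cb' : PBond (F.P K) (K - n) =>
        (EuclideanSpace.single (toBondIdx hj1 (∅ : Finset (Site (F.P K) (K - n + 1)))
            (Sum.inl ⟨cb, Finset.notMem_empty _, Finset.notMem_empty _⟩)) (1 : ℝ) :
          BondIdxSpace (twoScale (K - n) hj1 (∅ : Finset (Site (F.P K) (K - n + 1)))))
          ⟨⟨⟨K - n, hjlt⟩, cb'⟩, (lamBond_twoScale_empty_iff hj1 (K - n) cb').2 rfl⟩) =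
      fun cb' : PBond (F.P K) (K - n) => e ⟨⟨⟨K - n, Nat.lt_succ_self (K - n)⟩, cb'⟩, (lamBond_whole_iff (le_T3 F n K) (K - n) cb').2 rfl⟩ := by
    funext cb'
    rw [PiLp.single_apply]
    by_cases h : cb' = cb
    · subst h
      have hcond : (⟨⟨⟨K - n, hjlt⟩, cb'⟩, (lamBond_twoScale_empty_iff hj1 (K - n) cb').2 rfl⟩ :
          BondIdx (twoScale (K - n) hj1 (∅ : Finset (Site (F.P K) (K - n + 1))))) =
          toBondIdx hj1 (∅ : Finset (Site (F.P K) (K - n + 1))) (Sum.inl ⟨cb', Finset.notMem_empty _, Finset.notMem_empty _⟩) := rfl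
      rw [if_pos hcond, he]
    · rw [if_neg, he']
      · intro heq
        apply h
        have := congrArg (fun i : BondIdx (Domains.whole (K - n) (le_T3 F n K) : Domains (F.P K)) => i.1) heq
        simpa using this
      · intro heq
        apply h
        have := congrArg (fun i : BondIdx (twoScale (K - n) hj1 (∅ : Finset (Site (F.P K) (K - n + 1)))) => i.1) heq
        simpa [toBondIdx] using this
  -- the fine field: `flatH e = H_g(indicator cb) = hOp_ts (e_{ι cb})`
  have hfield : WithLp.toLp 2 (flatH F n K (Domains.whole (K - n) (le_T3 F n K)) e) =
      hOp (GE (twoScale (K - n) hj1 (∅ : Finset (Site (F.P K) (K - n + 1)))) hc (w := wLevel (F.P K) (K - n) (((F.L : ℝ) ^ (K - n)) ^ 3))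
          (wLevel_pos (j := K - n) ha)) (QsE (twoScale (K - n) hj1 (∅ : Finset (Site (F.P K) (K - n + 1)))))
        (EE (twoScale (K - n) hj1 (∅ : Finset (Site (F.P K) (K - n + 1)))) hc (w := wLevel (F.P K) (K - n) (((F.L : ℝ) ^ (K - n)) ^ 3))
          (wLevel_pos (j := K - n) ha))
        (EuclideanSpace.single (toBondIdx hj1 (∅ : Finset (Site (F.P K) (K - n + 1)))
            (Sum.inl ⟨cb, Finset.notMem_empty _, Finset.notMem_empty _⟩)) (1 : ℝ)) := by
    have h1 := toLp_H_eq_hOp_twoScale_empty (P := F.P K) hj1 hc (w := wLevel (F.P K) (K - n) (((F.L : ℝ) ^ (K - n)) ^ 3))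
      (wLevel_pos (j := K - n) ha)
      (fun p => (EuclideanSpace.single (toBondIdx hj1 (∅ : Finset (Site (F.P K) (K - n + 1)))
            (Sum.inl ⟨cb, Finset.notMem_empty _, Finset.notMem_empty _⟩)) (1 : ℝ) :
          BondIdxSpace (twoScale (K - n) hj1 (∅ : Finset (Site (F.P K) (K - n + 1))))) p)
    rw [hread] at h1
    have h2 : WithLp.toLp 2 (fun p => (EuclideanSpace.single (toBondIdx hj1 (∅ : Finset (Site (F.P K) (K - n + 1)))
            (Sum.inl ⟨cb, Finset.notMem_empty _, Finset.notMem_empty _⟩)) (1 : ℝ) :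
          BondIdxSpace (twoScale (K - n) hj1 (∅ : Finset (Site (F.P K) (K - n + 1))))) p) =
        EuclideanSpace.single (toBondIdx hj1 (∅ : Finset (Site (F.P K) (K - n + 1)))
            (Sum.inl ⟨cb, Finset.notMem_empty _, Finset.notMem_empty _⟩)) (1 : ℝ) := by
      ext p; rfl
    rw [h2] at h1
    refine Eq.trans ?_ h1
    ext b
    exact flatH_whole_apply F n K e b
  rw [hfield, FlatHCurlCurl.curlCurl_hOp _ hc (wLevel_pos (j := K - n) ha),
    B6Eq235TwoScaleV1.QsE_eq hc hj1 (∅ : Finset (Site (F.P K) (K - n + 1))) (w := wPrinted (F.P K) (K - n) ∅ (((F.L : ℝ) ^ (K - n)) ^ 3)),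
    B6Eq235TwoScaleV1.EE_eq hc hj1 (∅ : Finset (Site (F.P K) (K - n + 1))) ha]
  have hsym : (Equiv.ofBijective (toBondIdx hj1 (∅ : Finset (Site (F.P K) (K - n + 1)))) (toBondIdx_bijective hj1 ∅)).symm
      (toBondIdx hj1 (∅ : Finset (Site (F.P K) (K - n + 1))) (Sum.inl ⟨cb, Finset.notMem_empty _, Finset.notMem_empty _⟩)) =
      Sum.inl ⟨cb, Finset.notMem_empty _, Finset.notMem_empty _⟩ :=
    Equiv.ofBijective_symm_apply_apply _ (toBondIdx_bijective hj1 ∅) _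
  have haE : aE (twoScale (K - n) hj1 (∅ : Finset (Site (F.P K) (K - n + 1)))) (wLevel (F.P K) (K - n) (((F.L : ℝ) ^ (K - n)) ^ 3))
      (EuclideanSpace.single (toBondIdx hj1 (∅ : Finset (Site (F.P K) (K - n + 1)))
        (Sum.inl ⟨cb, Finset.notMem_empty _, Finset.notMem_empty _⟩)) (1 : ℝ)) =
      ((F.L : ℝ) ^ (K - n)) ^ 3 • EuclideanSpace.single (toBondIdx hj1 (∅ : Finset (Site (F.P K) (K - n + 1)))
        (Sum.inl ⟨cb, Finset.notMem_empty _, Finset.notMem_empty _⟩)) (1 : ℝ) := by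
    ext p
    rw [aE_apply, PiLp.smul_apply, smul_eq_mul, PiLp.single_apply]
    by_cases hp : p = toBondIdx hj1 (∅ : Finset (Site (F.P K) (K - n + 1))) (Sum.inl ⟨cb, Finset.notMem_empty _, Finset.notMem_empty _⟩)
    · subst hp
      simp [wLevel, toBondIdx]
    · simp [hp]
  simp only [LinearMap.comp_apply, LinearEquiv.coe_coe, LinearIsometryEquiv.coe_toLinearEquiv, LinearIsometryEquiv.symm_apply_apply, haE,
    map_smul, B6Eq235TwoScaleV1.reindex_symm_single, hsym]

/-! ## §3 Row (k3) at the one-level family -/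

open Classical in
/-- **ROW (k3) OF `HKernelRows` AT THE ONE-LEVEL FAMILY `Domains.whole (K − n)`**: for odd `L > 1` there are `δ₃ > 0`, `C₃ ≥ 0` such that for every member `F.L = L`,
heights `n < K`, P2 weights `w`, index bond `c` with indicator `e_c`, and fine bond `b`: `w 3 b·|(∂^{η*}∂^η flatH e_c)(b)| ≤ C₃·e^{−δ₃·distBI(b,c)}` — §2 and r03's
`blockBound_QsRinv_scaling` ((2.148)∘`Q*`) and `blockBound_Q_adjoint` (`Q*`, volume factor `η³` cancelled by `a = (L^{K−n})³`) at `d + 1 = 3`, `Λ′ = ∅`, window `a₀ = a₁ = 1`.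
[cite: Balaban1985Variational, (137) p.298, (161) p.303; Balaban1984PropagatorsII, (2.148)-(2.150) p.249] -/
theorem hKernelRow3_whole (L : ℕ) (hL : Odd L ∧ 1 < L) :
    ∃ δ₃ : ℝ, 0 < δ₃ ∧ ∃ C₃ : ℝ, 0 ≤ C₃ ∧ ∀ (F : T3Family), F.L = L → ∀ (n K : ℕ),
      ∀ (w : ℕ → PBond (F.P K) 0 → ℝ), IsLevWeight F n K (Domains.whole (K - n) (le_T3 F n K)) w →
      ∀ (c : BondIdx (Domains.whole (K - n) (le_T3 F n K) : Domains (F.P K))) (e : BondIdx (Domains.whole (K - n) (le_T3 F n K) : Domains (F.P K)) → ℝ),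
        e c = 1 → (∀ c', c' ≠ c → e c' = 0) → ∀ b : PBond (F.P K) 0,
        w 3 b * |(dcsE ((F.L : ℝ) ^ (K - n)) (dcE ((F.L : ℝ) ^ (K - n)) (WithLp.toLp 2 (flatH F n K (Domains.whole (K - n) (le_T3 F n K)) e)))) b| ≤
          C₃ * Real.exp (-(δ₃ * distBI (Domains.whole (K - n) (le_T3 F n K)) b c)) := by
  obtain ⟨δ, hδ, C, hC, hR⟩ := B6Cor28TwoScaleV1.blockBound_QsRinv_scaling 2 L (by norm_num) hL one_pos le_rfl
  set CQ : ℝ := Real.exp (δ + 1) * (Real.exp (δ * (2 * (L : ℝ) - 1)) * (2 * (2 + 1) : ℕ)) * B4Sect5Proof.latticeConst (2 + 1) 1 with hCQ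
  have hCQ0 : 0 ≤ CQ := by
    have := B4Sect5Proof.latticeConst_nonneg (2 + 1) (zero_le_one : (0 : ℝ) ≤ 1)
    positivity
  refine ⟨δ, hδ, C + CQ, add_nonneg hC hCQ0, fun F hF n K w hw c e he he' b => ?_⟩
  subst hF
  -- the index bond `c = (K − n, cb)`
  obtain ⟨⟨⟨j₀, hj₀⟩, cb⟩, hmem⟩ := c
  obtain rfl : j₀ = K - n := (lamBond_whole_iff (le_T3 F n K) j₀ cb).1 hmem
  have hw3 : w 3 b = 1 := FlatCubeOpsTextWhole.levWeight_whole_eq_one F n K (le_T3 F n K) w hw 3 b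
  rw [hw3, one_mul]
  have hj1 : K - n + 1 ≤ (F.P K).m + (F.P K).K := succ_le_T3 F n K
  have hL0 : (0 : ℝ) < (F.L : ℝ) := by exact_mod_cast lt_trans zero_lt_one F.hL.2
  have hLc : ((F.L : ℝ) ^ (K - n)) ≠ 0 := pow_ne_zero _ (Nat.cast_ne_zero.2 (F.P K).L_pos.ne')
  set a : ℝ := ((F.L : ℝ) ^ (K - n)) ^ 3 with ha_def
  have ha : 0 < a := by positivity
  -- §2 in r03's letters
  have hcc := curlCurl_flatH_whole_single F n K cb e he he'
  -- the window `1·(L^j)³ ≤ wPrinted a i ≤ 1·(L^j)³` at `a = (L^{K−n})³`, `Λ′ = ∅`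
  have hw0 : ∀ i : CIdx (P := F.P K) (K - n) ∅, 1 * ((F.L : ℝ) ^ (K - n)) ^ (2 + 1) ≤ wPrinted (F.P K) (K - n) ∅ a i := by
    rintro (o | i)
    · simp only [wPrinted, Sum.elim_inl, ha_def, one_mul]
      norm_num
    · exact absurd i.2 (by simp)
  have hw1 : ∀ i : CIdx (P := F.P K) (K - n) ∅, wPrinted (F.P K) (K - n) ∅ a i ≤ 1 * ((F.L : ℝ) ^ (K - n)) ^ (2 + 1) := by
    rintro (o | i)
    · simp only [wPrinted, Sum.elim_inl, ha_def, one_mul]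
      norm_num
    · exact absurd i.2 (by simp)
  have hRb := hR F.m K (K - n) hLc hj1 (∅ : Finset (Site (F.P K) (K - n + 1))) (wPrinted (F.P K) (K - n) ∅ a) hw0 hw1 b cb.src
  have hQb := B6Cor28TwoScaleV1.blockBound_Q_adjoint (d := 2) (L := F.L) (hd := by norm_num) (hL := hL) (m := F.m) (K := K) (j := K - n) hLc
    (∅ : Finset (Site (F.P K) (K - n + 1))) (w := wPrinted (F.P K) (K - n) ∅ a) hj1 hδ.le b cb.src
  -- the single index `i₀ = inl cb` is sited at `cb.src`, so its term is dominated by the sited sums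
  have hi₀mem : (Sum.inl ⟨cb, Finset.notMem_empty _, Finset.notMem_empty _⟩ : CIdx (P := F.P K) (K - n) ∅) ∈
      Finset.univ.filter (fun i : CIdx (P := F.P K) (K - n) ∅ =>
      (Sum.elim (fun o : OutBond (P := F.P K) (K - n) ∅ => o.1.src)
        (fun b₁ : InBond (P := F.P K) (K - n) ∅ => Site.blockSite b₁.1.src (fun _ => ⟨0, Params.L_pos _⟩)) :
        CIdx (P := F.P K) (K - n) ∅ → Site (F.P K) (K - n)) i = cb.src) := by
    simp
  have h1 := (Finset.single_le_sum (fun i _ => abs_nonneg _) hi₀mem).trans hRb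
  have h2 := mul_le_mul_of_nonneg_left ((Finset.single_le_sum (fun i _ => abs_nonneg _) hi₀mem).trans hQb) ha.le
  -- the distance in the exponent is `distBI`
  have hdist : distBI (Domains.whole (K - n) (le_T3 F n K)) b ⟨⟨⟨K - n, hj₀⟩, cb⟩, hmem⟩ =
      distSite (Mk (F.P K) (K - n)) (iterBlockOf (K - n) b.src) cb.src := by
    change ((F.L : ℝ)⁻¹) ^ ((K - n) - (K - n)) * distSite (Mk (F.P K) (K - n)) (iterBlockOf (K - n) b.src) cb.src = _
    rw [Nat.sub_self, pow_zero, one_mul]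
  have hts : distSite (Mk (F.P K) (K - n)) (iterBlockOf (K - n) b.src) cb.src =
      torusSupNorm (Mk (F.P K) (K - n)) (rep (Mk (F.P K) (K - n)) (iterBlockOf (K - n) b.src) - rep (Mk (F.P K) (K - n)) cb.src) :=
    B5Ineq110P12Lattice.distSite_eq_torusSupNorm (Mk (F.P K) (K - n)) (iterBlockOf (K - n) b.src) cb.src
  -- the volume factor: `a·η³ = 1`
  have hvol : a * (F.P K).eta (K - n) ^ (2 + 1) = 1 := by
    rw [ha_def]
    show ((F.L : ℝ) ^ (K - n)) ^ 3 * (((F.L : ℝ)⁻¹) ^ (K - n)) ^ (2 + 1) = 1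
    rw [show (2 + 1 : ℕ) = 3 from rfl, ← mul_pow, inv_pow, mul_inv_cancel₀ (pow_ne_zero _ hL0.ne'), one_pow]
  have hCQeq : ∀ E : ℝ, a * ((F.P K).eta (K - n) ^ (2 + 1) * Real.exp (δ + 1) *
      (Real.exp (δ * (2 * (F.L : ℝ) - 1)) * (2 * (2 + 1) : ℕ)) * B4Sect5Proof.latticeConst (2 + 1) 1 * E) = CQ * E := by
    intro E
    calc a * ((F.P K).eta (K - n) ^ (2 + 1) * Real.exp (δ + 1) * (Real.exp (δ * (2 * (F.L : ℝ) - 1)) * (2 * (2 + 1) : ℕ)) *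
          B4Sect5Proof.latticeConst (2 + 1) 1 * E)
        = (a * (F.P K).eta (K - n) ^ (2 + 1)) * (Real.exp (δ + 1) * (Real.exp (δ * (2 * (F.L : ℝ) - 1)) * (2 * (2 + 1) : ℕ)) *
          B4Sect5Proof.latticeConst (2 + 1) 1 * E) := by ring
      _ = CQ * E := by rw [hvol, one_mul, hCQ]
  rw [hcc, PiLp.sub_apply, PiLp.smul_apply, smul_eq_mul]
  refine (abs_sub _ _).trans ?_
  rw [abs_mul, abs_of_pos ha, add_mul]
  rw [hdist, hts]
  exact add_le_add h1 (h2.trans (le_of_eq (hCQeq _)))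

end Carrier

end Summit.QuantumFields.YangMills.Theorems.FlatHCurlCurlWhole

end
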